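import Summits.AtomisticToContinuum.Crystallization.Theorems.ChargedEnergyGapCellKernel
import HarnessLib

/-!
# NODE 108 «CellChecker» (lens-3 g92), PART C — the cost-cell certificate as DATA, its `Bool` checker, ONE soundness theorem

Door D1 (critic row 1637 (B)): the production form of record for the (D¹)/(T¹ᶜ) cost cells of the census of
`stmt-AtomisticToContinuum-14231`.  A cell certificate `CostCellCert` holds ONLY rationals / naturals / table indices:
the ρ-interval `[rho0, rho1]`, the depth box `lo ≤ d ≤ hi` and weight box `[L, U]` (slot order of `sext`), the corner roof bound `R`, the unit
`u` and `capLB`, the LP bases of the 64 corners (six columns = (row index into `T75Q`, axis relabelling, pole-flip pattern) + the six rows of the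
exact inverse `B⁻¹`), the corner ↦ basis map, and per axis a cap certificate (vacuous / NODE 101 floor / NODE 99 cap cell with its brackets).
`CostCellCert.check : CostCellCert → Bool` re-does, in exact ℚ arithmetic, every inequality NODE 107 `costCell_law` consumes — the twelve `φ`
evaluations of the weight box (`depthProfileQ`, exact), for each of the 64 corners `λ = B⁻¹W ≥ 0`, `Σ λᵢ·(relabelled row)ᵢ = W` slot-wise and
`Σ λᵢ sᵢ ≤ R`, the cap block, and the verdict `(3/100·2ρ₁)²·R ≤ capLB·u` — and ★★★ `CostCellCert.sound : c.check = true → (the (T¹ᶜ) inequality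
on c's box)` is proved THROUGH `costCell_law` (corner form; `corners_of_sext`, `roofVal_T75_le_six`, `capCell_lower`, `domCapK_ge_floor`): no new
analysis.  Census batches then land as `theorem batch_k : (cells.all CostCellCert.check) = true := by decide +kernel` (standard axioms) +
`CostCellCert.sound_of_all`.  No placeholders.
-/

namespace Summit.AtomisticToContinuum.Crystallization.Theorems.ChargedEnergyGapChartDial

/-! ## §108C.1 Enumeration combinators (six slots, 64 corners) -/

/-- Conjunction of a `Bool` test over the six slots `Fin 3 × Bool`. -/
def allSlots (f : Fin 3 × Bool → Bool) : Bool :=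
  f (0, true) && f (0, false) && f (1, true) && f (1, false) && f (2, true) && f (2, false)

/-- `allSlots f` says `f` holds at every slot. -/
theorem allSlots_iff (f : Fin 3 × Bool → Bool) : allSlots f = true ↔ ∀ p, f p = true := by
  constructor
  · intro h ⟨i, s⟩
    simp only [allSlots, Bool.and_eq_true] at h
    fin_cases i <;> cases s <;> simp_all
  · intro h; simp [allSlots, h]

/-- Conjunction of a test over `Bool`. -/
def allBool (f : Bool → Bool) : Bool := f false && f true

/-- `allBool f` says `f` holds at both Booleans. -/
theorem allBool_iff (f : Bool → Bool) : allBool f = true ↔ ∀ b, f b = true := by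
  simp [allBool, Bool.and_eq_true, Bool.forall_bool]

/-- Conjunction of a test over the 64 corners `(a, b, c, d, e, g) ∈ Bool⁶` (the order of `corners_of_sext`). -/
def allCorners (f : Bool → Bool → Bool → Bool → Bool → Bool → Bool) : Bool :=
  allBool fun a => allBool fun b => allBool fun c => allBool fun d => allBool fun e => allBool fun g => f a b c d e g

/-- `allCorners f` says `f` holds at every corner. -/
theorem allCorners_iff (f : Bool → Bool → Bool → Bool → Bool → Bool → Bool) :
    allCorners f = true ↔ ∀ a b c d e g, f a b c d e g = true := by
  simp [allCorners, allBool_iff]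

/-! ## §108C.2 The certificate datatype -/

/-- A basis column: the row index `k` into `T75Q`, the axis relabelling `g` and the pole-flip pattern `s` (the column is `row k ∘ relabel g s`). -/
structure ColRef where
  /-- row index into `T75Q` -/
  k : ℕ
  /-- axis relabelling -/
  g : Fin 6
  /-- pole-flip pattern -/
  s : Fin 8

/-- An LP basis certificate: six columns `c₀ … c₅` and the six rows `r₀ … r₅` of the exact inverse `B⁻¹` (`λᵢ = Σ_q rᵢ q · W q`). -/
structure BasisCert where
  /-- column 0 -/
  c₀ : ColRef
  /-- column 1 -/
  c₁ : ColRef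
  /-- column 2 -/
  c₂ : ColRef
  /-- column 3 -/
  c₃ : ColRef
  /-- column 4 -/
  c₄ : ColRef
  /-- column 5 -/
  c₅ : ColRef
  /-- row 0 of `B⁻¹` -/
  r₀ : Fin 3 × Bool → ℚ
  /-- row 1 of `B⁻¹` -/
  r₁ : Fin 3 × Bool → ℚ
  /-- row 2 of `B⁻¹` -/
  r₂ : Fin 3 × Bool → ℚ
  /-- row 3 of `B⁻¹` -/
  r₃ : Fin 3 × Bool → ℚ
  /-- row 4 of `B⁻¹` -/
  r₄ : Fin 3 × Bool → ℚ
  /-- row 5 of `B⁻¹` -/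
  r₅ : Fin 3 × Bool → ℚ

/-- One NODE 99 tilt-row bracket set `(rA, uA, rL, lL, l₀, l₁)` for one tilt constant. -/
structure TiltCertQ where
  /-- upper root bracket at the anchor -/
  rA : ℚ
  /-- `φ(rA) ≤ uA` -/
  uA : ℚ
  /-- lower root bracket at `lo` -/
  rL : ℚ
  /-- `lL ≤ φ(rL)` -/
  lL : ℚ
  /-- affine minorant, constant -/
  l₀ : ℚ
  /-- affine minorant, slope -/
  l₁ : ℚ

/-- The cap certificate of ONE axis `a` of a cell.  `kind = 0`: VACUOUS — axis `a` never carries the least pole sum on the box, witnessed by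
axis `wit` (`hi⁺ + hi⁻` of `wit` `<` `lo⁺ + lo⁻` of `a`); `kind = 1`: NODE 101 FLOOR (`241/2 ≤ t_lo`, `capLB ≤ 451/10`); otherwise NODE 99
CAP CELL with anchor `anc`, pole interval `[dlo, dhi]`, pole chord `p₀ + p₁ d`, the three tilt rows and the certified minorant value `Bmin`
(price = the swap price of NODE 100, `isRoofDualFeasible_T75_sext_swap`). -/
structure AxisCap where
  /-- 0 vacuous, 1 floor, else cap cell -/
  kind : ℕ
  /-- vacuity witness axis -/
  wit : Fin 3
  /-- tilt anchor -/
  anc : ℚ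
  /-- pole interval, low end -/
  dlo : ℚ
  /-- pole interval, high end -/
  dhi : ℚ
  /-- pole chord, constant -/
  p₀ : ℚ
  /-- pole chord, slope -/
  p₁ : ℚ
  /-- tilt row `c = 439/485` -/
  t₁ : TiltCertQ
  /-- tilt row `c = 527/485` -/
  t₂ : TiltCertQ
  /-- tilt row `c = 483/485` -/
  t₃ : TiltCertQ
  /-- certified lower bound of the cap minorant on the cell -/
  Bmin : ℚ

/-- The all-zero tilt bracket (placeholder of vacuous / floor axis certificates). -/
def TiltCertQ.zero : TiltCertQ := ⟨0, 0, 0, 0, 0, 0⟩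

/-- The VACUOUS axis certificate with witness axis `wit`. -/
def AxisCap.vacuous (wit : Fin 3) : AxisCap := ⟨0, wit, 0, 0, 0, 0, 0, .zero, .zero, .zero, 0⟩

/-- The FLOOR axis certificate (NODE 101: `t ≥ 241/2`). -/
def AxisCap.floor : AxisCap := ⟨1, 0, 0, 0, 0, 0, 0, .zero, .zero, .zero, 0⟩

/-- ★ **THE COST-CELL CERTIFICATE** (all-rational payload of one (D¹)/(T¹ᶜ) cell in corner form, COSTCELL-SPEC-v2 §1): ρ-interval, depth box
`lo/hi`, weight box `L/U` (slot order of `sext`), corner roof bound `R`, unit `u`, `capLB`, the LP bases, the corner ↦ basis map (64 indices into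
`bases`, corner `(a,b,c,d,e,g)` at position `32a + 16b + 8c + 4d + 2e + g`, `true ↦ U`), and the three axis cap certificates. -/
structure CostCellCert where
  /-- ρ-interval, low end -/
  rho0 : ℚ
  /-- ρ-interval, high end -/
  rho1 : ℚ
  /-- depth box, low corner -/
  lo : Fin 3 × Bool → ℚ
  /-- depth box, high corner -/
  hi : Fin 3 × Bool → ℚ
  /-- weight box, low corner -/
  L : Fin 3 × Bool → ℚ
  /-- weight box, high corner -/
  U : Fin 3 × Bool → ℚ
  /-- corner roof bound -/
  R : ℚ
  /-- the unit `u` of `domCapK` -/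
  u : ℚ
  /-- certified cap lower bound (in units of `u`) -/
  capLB : ℚ
  /-- LP bases -/
  bases : List BasisCert
  /-- corner ↦ basis index -/
  cornerBasis : List ℕ
  /-- the three axis cap certificates -/
  cap : Fin 3 → AxisCap

/-! ## §108C.3 The corner check: one exact LP certificate -/

/-- `Σ_q r q · W q` over the six slots. -/
def dotQ (r W : Fin 3 × Bool → ℚ) : ℚ :=
  r (0, true) * W (0, true) + r (0, false) * W (0, false) + r (1, true) * W (1, true) + r (1, false) * W (1, false) +
    r (2, true) * W (2, true) + r (2, false) * W (2, false)

/-- ★ The rational CORNER CERTIFICATE of basis `B` at corner weight `W` against the bound `R`: the six rows exist in `T75Q`, `λ = B⁻¹W ≥ 0`,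
`W = Σ λᵢ · (rowᵢ ∘ relabel gᵢ sᵢ)` slot-wise (exact), and `Σ λᵢ sᵢ ≤ R`. -/
def cornerCheck (B : BasisCert) (R : ℚ) (W : Fin 3 × Bool → ℚ) : Bool :=
  match T75Q[B.c₀.k]?, T75Q[B.c₁.k]?, T75Q[B.c₂.k]?, T75Q[B.c₃.k]?, T75Q[B.c₄.k]?, T75Q[B.c₅.k]? with
  | some e₀, some e₁, some e₂, some e₃, some e₄, some e₅ =>
    let l₀ := dotQ B.r₀ W
    let l₁ := dotQ B.r₁ W
    let l₂ := dotQ B.r₂ W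
    let l₃ := dotQ B.r₃ W
    let l₄ := dotQ B.r₄ W
    let l₅ := dotQ B.r₅ W
    decide (0 ≤ l₀ ∧ 0 ≤ l₁ ∧ 0 ≤ l₂ ∧ 0 ≤ l₃ ∧ 0 ≤ l₄ ∧ 0 ≤ l₅ ∧
        l₀ * e₀.2 + l₁ * e₁.2 + l₂ * e₂.2 + l₃ * e₃.2 + l₄ * e₄.2 + l₅ * e₅.2 ≤ R) &&
      allSlots fun p => decide (W p = l₀ * e₀.1 (relabel B.c₀.g B.c₀.s p) + l₁ * e₁.1 (relabel B.c₁.g B.c₁.s p) +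
        l₂ * e₂.1 (relabel B.c₂.g B.c₂.s p) + l₃ * e₃.1 (relabel B.c₃.g B.c₃.s p) + l₄ * e₄.1 (relabel B.c₄.g B.c₄.s p) +
        l₅ * e₅.1 (relabel B.c₅.g B.c₅.s p))
  | _, _, _, _, _, _ => false

/-- ★★ SOUNDNESS OF THE CORNER CHECK: `roofVal T75 (W) ≤ R` (rows by index `castRow_mem_T75_of_getElem?`, then `roofVal_T75_le_six`). -/
theorem cornerCheck_sound {B : BasisCert} {R : ℚ} {W : Fin 3 × Bool → ℚ} (h : cornerCheck B R W = true) :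
    roofVal T75 (castW W) ≤ (R : ℝ) := by
  unfold cornerCheck at h
  split at h
  · next e₀ e₁ e₂ e₃ e₄ e₅ k₀ k₁ k₂ k₃ k₄ k₅ =>
    simp only [Bool.and_eq_true, decide_eq_true_eq, allSlots_iff] at h
    obtain ⟨⟨hl₀, hl₁, hl₂, hl₃, hl₄, hl₅, hR⟩, hS⟩ := h
    refine (roofVal_T75_le_six (castRow_mem_T75_of_getElem? k₀) (castRow_mem_T75_of_getElem? k₁)
      (castRow_mem_T75_of_getElem? k₂) (castRow_mem_T75_of_getElem? k₃) (castRow_mem_T75_of_getElem? k₄)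
      (castRow_mem_T75_of_getElem? k₅) B.c₀.g B.c₁.g B.c₂.g B.c₃.g B.c₄.g B.c₅.g B.c₀.s B.c₁.s B.c₂.s B.c₃.s B.c₄.s B.c₅.s
      (l₀ := (dotQ B.r₀ W : ℝ)) (l₁ := (dotQ B.r₁ W : ℝ)) (l₂ := (dotQ B.r₂ W : ℝ)) (l₃ := (dotQ B.r₃ W : ℝ))
      (l₄ := (dotQ B.r₄ W : ℝ)) (l₅ := (dotQ B.r₅ W : ℝ)) (by exact_mod_cast hl₀) (by exact_mod_cast hl₁) (by exact_mod_cast hl₂)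
      (by exact_mod_cast hl₃) (by exact_mod_cast hl₄) (by exact_mod_cast hl₅) (fun p => ?_)).trans ?_
    · dsimp only [castRow, castW]
      exact_mod_cast hS p
    · dsimp only [castRow]
      exact_mod_cast hR
  · exact absurd h Bool.false_ne_true

/-- The weight vector of corner `(a, b, c, d, e, g)` of the box `[L, U]` (`true ↦ U`), in the `cond` normal form of `corners_of_sext`. -/
def cornerW (L U : Fin 3 × Bool → ℚ) (a b c d e g : Bool) : Fin 3 × Bool → ℚ :=
  sextQ (cond a (U (0, true)) (L (0, true))) (cond b (U (0, false)) (L (0, false))) (cond c (U (1, true)) (L (1, true)))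
    (cond d (U (1, false)) (L (1, false))) (cond e (U (2, true)) (L (2, true))) (cond g (U (2, false)) (L (2, false)))

/-- [cast] `Rat.cast` through `cond`. -/
theorem cast_cond (x : Bool) (s t : ℚ) : ((cond x s t : ℚ) : ℝ) = cond x (s : ℝ) (t : ℝ) := by cases x <;> rfl

/-- [cast] the cast corner weight is the `sext`/`cond` corner of the cast box. -/
theorem castW_cornerW (L U : Fin 3 × Bool → ℚ) (a b c d e g : Bool) : castW (cornerW L U a b c d e g) =
    sext (cond a (castW U (0, true)) (castW L (0, true))) (cond b (castW U (0, false)) (castW L (0, false)))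
      (cond c (castW U (1, true)) (castW L (1, true))) (cond d (castW U (1, false)) (castW L (1, false)))
      (cond e (castW U (2, true)) (castW L (2, true))) (cond g (castW U (2, false)) (castW L (2, false))) := by
  unfold cornerW; rw [castW_sextQ]; simp only [cast_cond]

/-- `n` if `x` else `0` (corner position bits). -/
def bit (x : Bool) (n : ℕ) : ℕ := cond x n 0

/-- The basis certificate assigned to the corner at position `i`. -/
def CostCellCert.basisAt (c : CostCellCert) (i : ℕ) : Option BasisCert :=
  match c.cornerBasis[i]? with
  | none => none
  | some j => c.bases[j]?

/-- The check of corner `(a, b, c', d, e, g)`. -/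
def CostCellCert.cornerOK (c : CostCellCert) (a b c' d e g : Bool) : Bool :=
  match c.basisAt (bit a 32 + bit b 16 + bit c' 8 + bit d 4 + bit e 2 + bit g 1) with
  | none => false
  | some B => cornerCheck B c.R (cornerW c.L c.U a b c' d e g)

/-- ★ The COST block: all 64 corner certificates. -/
def CostCellCert.costCheck (c : CostCellCert) : Bool := allCorners c.cornerOK

/-- ★★ Soundness of the cost block: the `∀ β` corner hypothesis `hc` of `costCell_law` (dispatcher `corners_of_sext`). -/
theorem CostCellCert.costCheck_sound (c : CostCellCert) (h : c.costCheck = true) :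
    ∀ β : Fin 3 × Bool → Bool, roofVal T75 (fun q => if β q then castW c.U q else castW c.L q) ≤ (c.R : ℝ) := by
  refine corners_of_sext fun a b c' d e g => ?_
  have hc := (allCorners_iff _).1 h a b c' d e g
  unfold CostCellCert.cornerOK at hc
  split at hc
  · exact absurd hc Bool.false_ne_true
  · rw [← castW_cornerW]; exact cornerCheck_sound hc

/-! ## §108C.4 The weight box and the cap block -/

/-- ★ The WEIGHT-BOX block: `0 ≤ L ≤ φ(lo)` and `φ(hi) ≤ U` slot-wise, twelve exact `φ` evaluations. -/
def CostCellCert.wbCheck (c : CostCellCert) : Bool :=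
  allSlots fun q => decide (0 ≤ c.L q ∧ c.L q ≤ depthProfileQ 160 (c.lo q) ∧ depthProfileQ 160 (c.hi q) ≤ c.U q)

/-- Soundness of the weight-box block: hypothesis `hWB` of `costCell_law`. -/
theorem CostCellCert.wbCheck_sound (c : CostCellCert) (h : c.wbCheck = true) :
    ∀ q, 0 ≤ castW c.L q ∧ castW c.L q ≤ depthProfile 160 (castW c.lo q) ∧ depthProfile 160 (castW c.hi q) ≤ castW c.U q := by
  intro q
  obtain ⟨h1, h2, h3⟩ := decide_eq_true_eq.mp ((allSlots_iff _).1 h q)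
  refine ⟨by exact_mod_cast h1, ?_, ?_⟩
  · have := qle h2; rw [cast_depthProfileQ] at this; push_cast at this; exact this
  · have := qle h3; rw [cast_depthProfileQ] at this; push_cast at this; exact this

/-- The induced `t`-box of axis `a`: low end `(lo⁺ + lo⁻)/2 + ρ₀`. -/
def CostCellCert.tlo (c : CostCellCert) (a : Fin 3) : ℚ := (c.lo (a, true) + c.lo (a, false)) / 2 + c.rho0

/-- The induced `t`-box of axis `a`: high end `(hi⁺ + hi⁻)/2 + ρ₁`. -/
def CostCellCert.thi (c : CostCellCert) (a : Fin 3) : ℚ := (c.hi (a, true) + c.hi (a, false)) / 2 + c.rho1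

/-- One tilt row check of axis cap `k` at constant `cst`. -/
def CostCellCert.tiltOK (c : CostCellCert) (a : Fin 3) (k : AxisCap) (cst : ℚ) (t : TiltCertQ) : Bool :=
  tiltRowCheck cst c.rho0 c.rho1 k.anc (c.tlo a) (c.thi a) t.rA t.uA t.rL t.lL t.l₀ t.l₁

/-- ★ The CAP block of axis `a` (vacuous / floor / NODE 99 cap cell with the swap price). -/
def CostCellCert.capCheck (c : CostCellCert) (a : Fin 3) : Bool :=
  let k := c.cap a
  if k.kind = 0 then decide (c.hi (k.wit, true) + c.hi (k.wit, false) < c.lo (a, true) + c.lo (a, false))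
  else if k.kind = 1 then decide (241 / 2 ≤ c.tlo a ∧ c.capLB ≤ 451 / 10 ∧ 0 ≤ c.u)
  else
    capGeomCheck c.rho0 c.rho1 k.anc (c.tlo a) (c.thi a) k.dlo k.dhi && poleRowCheck k.dlo k.dhi k.p₀ k.p₁ &&
    c.tiltOK a k (439 / 485) k.t₁ && c.tiltOK a k (527 / 485) k.t₂ && c.tiltOK a k (483 / 485) k.t₃ &&
    decide (0 ≤ k.Bmin ∧ 0 ≤ c.u ∧
      k.Bmin ≤ capMinorantQ (-(781 / 6000) + -(763 / 6000)) (955 / 18000) (32647 / 450000) (917 / 18000 + 917 / 18000)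
        k.p₀ k.p₁ k.t₁.l₀ k.t₁.l₁ k.t₂.l₀ k.t₂.l₁ k.t₃.l₀ k.t₃.l₁ (c.tlo a) c.rho0 ∧
      k.Bmin ≤ capMinorantQ (-(781 / 6000) + -(763 / 6000)) (955 / 18000) (32647 / 450000) (917 / 18000 + 917 / 18000)
        k.p₀ k.p₁ k.t₁.l₀ k.t₁.l₁ k.t₂.l₀ k.t₂.l₁ k.t₃.l₀ k.t₃.l₁ (c.tlo a) c.rho1 ∧
      k.Bmin ≤ capMinorantQ (-(781 / 6000) + -(763 / 6000)) (955 / 18000) (32647 / 450000) (917 / 18000 + 917 / 18000)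
        k.p₀ k.p₁ k.t₁.l₀ k.t₁.l₁ k.t₂.l₀ k.t₂.l₁ k.t₃.l₀ k.t₃.l₁ (c.thi a) c.rho0 ∧
      k.Bmin ≤ capMinorantQ (-(781 / 6000) + -(763 / 6000)) (955 / 18000) (32647 / 450000) (917 / 18000 + 917 / 18000)
        k.p₀ k.p₁ k.t₁.l₀ k.t₁.l₁ k.t₂.l₀ k.t₂.l₁ k.t₃.l₀ k.t₃.l₁ (c.thi a) c.rho1 ∧
      c.capLB * c.u ≤ kappaQ (c.thi a) * (c.u / 10 + 103 / 100 * ((3 / 100 * (2 * c.rho0)) ^ 2 * k.Bmin)))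

/-- ★★ Soundness of the cap block of axis `a`: hypothesis `hcap a` of `costCell_law` (vacuous by the witness axis; floor by
`domCapK_ge_floor`; cap cell by NODE 99 `capCell_lower` with `isRoofDualFeasible_T75_sext_swap`). -/
theorem CostCellCert.capCheck_sound (c : CostCellCert) (a : Fin 3) (h : c.capCheck a = true) :
    (∀ b : Fin 3, castW c.lo (a, true) + castW c.lo (a, false) ≤ castW c.hi (b, true) + castW c.hi (b, false)) →
    ∀ ρ' t : ℝ, (c.rho0 : ℝ) ≤ ρ' → ρ' ≤ c.rho1 → (castW c.lo (a, true) + castW c.lo (a, false)) / 2 + c.rho0 ≤ t →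
      t ≤ (castW c.hi (a, true) + castW c.hi (a, false)) / 2 + c.rho1 → (c.capLB : ℝ) * c.u ≤ domCapK c.u 160 (3 / 100) ρ' t := by
  intro hb ρ' t h₀ h₁ ht₀ ht₁
  have htlo : ((c.tlo a : ℚ) : ℝ) ≤ t := by unfold CostCellCert.tlo; push_cast; exact ht₀
  have hthi : t ≤ ((c.thi a : ℚ) : ℝ) := by unfold CostCellCert.thi; push_cast; exact ht₁
  unfold CostCellCert.capCheck at h
  simp only at h
  split_ifs at h with hk0 hk1
  · have hlt := qlt (decide_eq_true_eq.mp h); push_cast at hlt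
    exact absurd (hb (c.cap a).wit) (not_le.mpr hlt)
  · obtain ⟨h241, h451, hu⟩ := decide_eq_true_eq.mp h
    have hu' : (0 : ℝ) ≤ c.u := by exact_mod_cast hu
    have h241' : (241 / 2 : ℝ) ≤ t := by have := qle h241; push_cast at this; exact this.trans htlo
    have h451' : (c.capLB : ℝ) ≤ 451 / 10 := by have := qle h451; push_cast at this; exact this
    calc (c.capLB : ℝ) * c.u ≤ 451 / 10 * c.u := mul_le_mul_of_nonneg_right h451' hu'
      _ ≤ domCapK c.u 160 (3 / 100) ρ' t := domCapK_ge_floor hu' 160 (3 / 100) ρ' h241'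
  · simp only [Bool.and_eq_true, CostCellCert.tiltOK] at h
    obtain ⟨⟨⟨⟨⟨hg, hP⟩, hT₁⟩, hT₂⟩, hT₃⟩, hrest⟩ := h
    obtain ⟨hB, hu, hc₀₀, hc₀₁, hc₁₀, hc₁₁, hcap⟩ := decide_eq_true_eq.mp hrest
    refine capCell_lower (capGeomCheck_sound hg) (poleRowCheck_sound hP) (tiltRowCheck_sound (by norm_num) hT₁)
      (tiltRowCheck_sound (by norm_num) hT₂) (tiltRowCheck_sound (by norm_num) hT₃) isRoofDualFeasible_T75_sext_swap
      (by norm_num) (by norm_num) (by norm_num) (by norm_num) (show (0 : ℝ) ≤ ((c.cap a).Bmin : ℝ) by exact_mod_cast hB) ?_ ?_ ?_ ?_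
      (show (0 : ℝ) ≤ (c.u : ℝ) by exact_mod_cast hu) ?_ ρ' t h₀ h₁ htlo hthi
    · have := qle hc₀₀; rw [cast_capMinorantQ] at this; push_cast at this; exact this
    · have := qle hc₀₁; rw [cast_capMinorantQ] at this; push_cast at this; exact this
    · have := qle hc₁₀; rw [cast_capMinorantQ] at this; push_cast at this; exact this
    · have := qle hc₁₁; rw [cast_capMinorantQ] at this; push_cast at this; exact this
    · have := qle hcap; push_cast [cast_kappaQ] at this; exact this

/-! ## §108C.5 The checker and its soundness -/

/-- ★★★ **THE CELL CHECKER**: `0 < ρ₀`, the verdict `(3/100·2ρ₁)²·R ≤ capLB·u`, the weight box, the 64 corners, the three cap blocks. -/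
def CostCellCert.check (c : CostCellCert) : Bool :=
  decide (0 < c.rho0 ∧ (3 / 100 * (2 * c.rho1)) ^ 2 * c.R ≤ c.capLB * c.u) && c.wbCheck && c.costCheck &&
    c.capCheck 0 && c.capCheck 1 && c.capCheck 2

/-- ★★★ **SOUNDNESS**: a certificate that checks proves the (T¹ᶜ) inequality on its box — `ρ ∈ [rho0, rho1]`, vertex depths in `[lo, hi]` ⇒
`feetHoleCost ≤ domCapK u` — by NODE 107 `costCell_law` (corner form).  This is the ONLY theorem a census batch needs besides `decide`. -/
theorem CostCellCert.sound (c : CostCellCert) (h : c.check = true) :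
    ∀ ρ : ℝ, (c.rho0 : ℝ) ≤ ρ → ρ ≤ c.rho1 → ∀ dt : (Fin 3 → ℤ) → ℝ,
      (∀ q, castW c.lo q ≤ dt (holeVertex 0 q) ∧ dt (holeVertex 0 q) ≤ castW c.hi q) →
      feetHoleCost 160 (3 / 100) ρ dt 0 ≤ domCapK c.u 160 (3 / 100) ρ (chargeDepth ρ dt 0) := by
  simp only [CostCellCert.check, Bool.and_eq_true, decide_eq_true_eq] at h
  obtain ⟨⟨⟨⟨⟨⟨hρ₀, hfin⟩, hwb⟩, hcost⟩, hc0⟩, hc1⟩, hc2⟩ := h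
  have hcap : ∀ a : Fin 3, c.capCheck a = true := by
    intro a; fin_cases a
    exacts [hc0, hc1, hc2]
  exact costCell_law (c.wbCheck_sound hwb) (c.costCheck_sound hcost) (by exact_mod_cast hρ₀) (fun a => c.capCheck_sound a (hcap a))
    (by have := qle hfin; push_cast at this; exact this)

/-- ★ Batch form: every certificate of a list that checks (`cells.all CostCellCert.check = true`, by `decide`) proves its cell's inequality. -/
theorem CostCellCert.sound_of_all {cs : List CostCellCert} (h : cs.all CostCellCert.check = true) {c : CostCellCert} (hc : c ∈ cs) :
    ∀ ρ : ℝ, (c.rho0 : ℝ) ≤ ρ → ρ ≤ c.rho1 → ∀ dt : (Fin 3 → ℤ) → ℝ,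
      (∀ q, castW c.lo q ≤ dt (holeVertex 0 q) ∧ dt (holeVertex 0 q) ≤ castW c.hi q) →
      feetHoleCost 160 (3 / 100) ρ dt 0 ≤ domCapK c.u 160 (3 / 100) ρ (chargeDepth ρ dt 0) :=
  c.sound (List.all_eq_true.mp h c hc)

end Summit.AtomisticToContinuum.Crystallization.Theorems.ChargedEnergyGapChartDial
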